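import Summits.SmoothPoincare4.SmoothPoincare4.Theorems.ConvexBisectionAcyclicBisectionExistsBeltPageTubeGlue
import Summits.SmoothPoincare4.SmoothPoincare4.Theorems.ConvexBisectionAcyclicBisectionExistsBeltSlideToTubeAny
import HarnessLib

/-!
# Gluing the boundary tube of a Lefschetz handle to the twisted page tube, III: the shrunk tubes of the assembly
(node T3c-1′ `node_belt_isotopic_pushoff` of the sub-goal T3 of stub `stub_steinRealisation` (NF6), line
`modp-braid-orbits`, crux `ConvexBisection.AcyclicBisectionExists`, item stmt-SmoothPoincare4-10508;
wave 4, worker Y1, lead c5; brick (3c)-GLUE part 3 = the tube plumbing of the assembly of T3c-1′, registered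
sub-goal `helper_belt_pageTube_prep`)

The assembly of node T3c-1′ concatenates, for the `j`-th handle: V6's belt-circle slide, Z5's tube comparison
`helper_belt_slideToTube` (against a second tube `Φ₃` with the glue hypotheses AND a small target), Y2's (3d)
isotopy `helper_belt_tubePushoff` (inside a tube `Φ'` related to `Φ₃` by a fibre twist), and the page rotation.
All stages of (3c)–(3d) must stay inside a prescribed open neighbourhood `O` of the attaching circle in
`∂ Base g` (off the other handles and off the other components' sectors: the link condition).  This file fixes
the two tubes once and for all from Z4's page tube `Φ` (`helper_exists_pageTube`, CORE and FIBRE DERIVATIVE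
clauses): with the twist `σ = t_j` of `helper_belt_pageTube_glue`, its sign `s`, one radial shrink `μ ∈ (0, 1]`,

  `Φ' := shrinkTube Φ μ`,   `Φ₃ := shrinkTube (twistTube Φ σ) μ`   (`Φ₃ (ψ, v) = Φ' (ψ, fibreRot σ ψ v)`),

it proves: both targets lie in `O`; `Φ₃` satisfies `hcore / hsgn / hang / hsmall` against `(h j).boundaryTube`
(Z5's hypotheses, transferred through the shrink by `…BeltTubeShrink.lean`); `Φ'` satisfies Z4's CORE and FIBRE
DERIVATIVE clauses with `(r, κ)` replaced by `(μ r, μ κ)` (Y2's hypotheses for (4)); points of `Φ'` off the zero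
section are off all cores and inside `range (h j)` (for the `jA`-push and the link condition); and the slide
direction `b` with `σ s slideSign b = -1` (Y2's winding hypothesis for (3d)) exists.

Everything is proved; no named facts, no `sorry`.

## References
* A. A. Kosinski, *Differential Manifolds*, Academic Press (1993), III (3.1), (3.5). [Kosinski1993]
-/

noncomputable section

-- the prescribed namespace `Summit.<P>.<Sub>.…` duplicates `SmoothPoincare4` (P = Sub)
set_option linter.dupNamespace false

open scoped Manifold ContDiff Topology
open Set Function Metric Filter

namespace Summit.SmoothPoincare4.SmoothPoincare4.Theorems.AcyclicBisectionExists.ModpBraidOrbits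

open Literature.Topology.FourManifolds Literature.Topology.FourManifolds.LefschetzBase
  Literature.Topology.FourManifolds.HandleAttachingMap Literature.Geometry.Symplectic

variable {g : ℕ}

/-! ### §1 The two shrunk tubes -/

section Tubes

variable (Φ : CircleTube (bBase g).carrier) {σ : ℝ} (hσ : σ ^ 2 = 1) {μ : ℝ} (hμ : 0 < μ) (hμ1 : μ ≤ 1)

/-- **`Φ₃ (ψ, v) = Φ' (ψ, fibreRot σ ψ v)`**: the shrink of the twisted tube is the twist of the shrunk tube, on
points (the relation `hΦ₂` of `helper_belt_tubePushoff` with `μ = 1`). [folklore] -/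
theorem shrinkTube_twistTube_apply (ψ : sphere (0 : EuclideanSpace ℝ (Fin 2)) 1) (v : EuclideanSpace ℝ (Fin 2)) :
    (bBase g).incl ((shrinkTube (twistTube Φ σ hσ) hμ hμ1).toHomeo (ψ, v)) =
      (bBase g).incl ((shrinkTube Φ hμ hμ1).toHomeo (ψ, (1 : ℝ) • fibreRot σ (ψ : EuclideanSpace ℝ (Fin 2)) v)) := by
  rw [one_smul, shrinkTube_apply, shrinkTube_apply, twistTube_apply]
  show (bBase g).incl (Φ.toHomeo (ψ, fibreRot σ (ψ : EuclideanSpace ℝ (Fin 2)) (μ • v))) =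
    (bBase g).incl (Φ.toHomeo (ψ, μ • fibreRot σ (ψ : EuclideanSpace ℝ (Fin 2)) v))
  rw [fibreRot_smul]

/-- `Φ (𝕊¹ × B(0, μ))` lies in the target of the shrunk tube. [folklore] -/
theorem image_ball_subset_shrinkTube_target :
    Φ.toHomeo '' ((univ : Set (sphere (0 : EuclideanSpace ℝ (Fin 2)) 1)) ×ˢ ball (0 : EuclideanSpace ℝ (Fin 2)) μ) ⊆
      (shrinkTube Φ hμ hμ1).toHomeo.target := by
  rintro y ⟨⟨ψ, v⟩, ⟨-, hv⟩, rfl⟩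
  rw [mem_ball_zero_iff] at hv
  have hq : ((ψ, μ⁻¹ • v) : (sphere (0 : EuclideanSpace ℝ (Fin 2)) 1) × EuclideanSpace ℝ (Fin 2)) ∈
      (shrinkTube Φ hμ hμ1).toHomeo.source := by
    rw [(shrinkTube Φ hμ hμ1).mem_source_iff, norm_smul, Real.norm_eq_abs, abs_of_pos (inv_pos.2 hμ)]
    rwa [inv_mul_lt_iff₀ hμ, mul_one]
  have e : (shrinkTube Φ hμ hμ1).toHomeo (ψ, μ⁻¹ • v) = Φ.toHomeo (ψ, v) := by
    rw [shrinkTube_apply]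
    show Φ.toHomeo (ψ, μ • μ⁻¹ • v) = Φ.toHomeo (ψ, v)
    rw [smul_smul, mul_inv_cancel₀ hμ.ne', one_smul]
  rw [← e]
  exact (shrinkTube Φ hμ hμ1).toHomeo.map_source hq

/-- The target of `Φ₃ = shrinkTube (twistTube Φ σ) μ` lies in the target of `Φ' = shrinkTube Φ μ`. [folklore] -/
theorem shrinkTube_twistTube_target_subset :
    (shrinkTube (twistTube Φ σ hσ) hμ hμ1).toHomeo.target ⊆ (shrinkTube Φ hμ hμ1).toHomeo.target := by
  intro y hy
  obtain ⟨⟨ψ, v⟩, ⟨-, hv⟩, rfl⟩ := shrinkTube_target_subset (twistTube Φ σ hσ) hμ hμ1 hy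
  apply image_ball_subset_shrinkTube_target Φ hμ hμ1
  refine ⟨(ψ, fibreRot σ (ψ : EuclideanSpace ℝ (Fin 2)) v), ⟨mem_univ _, ?_⟩, rfl⟩
  rw [mem_ball_zero_iff] at hv ⊢
  rwa [BlowDownFlat.norm_fibreRot_sphere hσ]

/-- **Z4's FIBRE DERIVATIVE clause for the shrunk tube**: `(r, κ) ↦ (μ r, μ κ)`. [folklore] -/
theorem hasFDerivAt_shrinkTube_fibre (t : ℝ) {V W : EuclideanSpace ℝ (Fin 4)}
    (hL : HasFDerivAt (fun v : EuclideanSpace ℝ (Fin 2) => ((bBase g).incl (Φ.toHomeo (circlePt t, v))).1)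
      ((EuclideanSpace.proj (𝕜 := ℝ) (0 : Fin 2)).smulRight V + (EuclideanSpace.proj (𝕜 := ℝ) (1 : Fin 2)).smulRight W) 0) :
    HasFDerivAt (fun v : EuclideanSpace ℝ (Fin 2) => ((bBase g).incl ((shrinkTube Φ hμ hμ1).toHomeo (circlePt t, v))).1)
      ((EuclideanSpace.proj (𝕜 := ℝ) (0 : Fin 2)).smulRight (μ • V) + (EuclideanSpace.proj (𝕜 := ℝ) (1 : Fin 2)).smulRight (μ • W)) 0 := by
  have hL' : HasFDerivAt (fun v : EuclideanSpace ℝ (Fin 2) => ((bBase g).incl (Φ.toHomeo (circlePt t, v))).1)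
      ((EuclideanSpace.proj (𝕜 := ℝ) (0 : Fin 2)).smulRight V + (EuclideanSpace.proj (𝕜 := ℝ) (1 : Fin 2)).smulRight W)
      ((μ • ContinuousLinearMap.id ℝ (EuclideanSpace ℝ (Fin 2))) 0) := by
    rw [map_zero]; exact hL
  have hc := hL'.comp 0 (μ • ContinuousLinearMap.id ℝ (EuclideanSpace ℝ (Fin 2))).hasFDerivAt
  have e : ((EuclideanSpace.proj (𝕜 := ℝ) (0 : Fin 2)).smulRight V + (EuclideanSpace.proj (𝕜 := ℝ) (1 : Fin 2)).smulRight W).comp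
      (μ • ContinuousLinearMap.id ℝ (EuclideanSpace ℝ (Fin 2))) =
      (EuclideanSpace.proj (𝕜 := ℝ) (0 : Fin 2)).smulRight (μ • V) + (EuclideanSpace.proj (𝕜 := ℝ) (1 : Fin 2)).smulRight (μ • W) := by
    ext v i
    simp [ContinuousLinearMap.smulRight_apply, smul_smul, mul_comm μ]
  rw [e] at hc
  exact hc

/-- **Z4's FIBRE DERIVATIVE clause for the shrunk tube, in Z4's form**: `(r, κ) ↦ (μ r, μ κ)`. [folklore] -/
theorem hasFDerivAt_shrinkTube_fibre' {K : sphere (0 : EuclideanSpace ℝ (Fin 2)) 1 → Base g} {κ r : ℝ}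
    (hder : ∀ t : ℝ, HasFDerivAt (fun v : EuclideanSpace ℝ (Fin 2) => ((bBase g).incl (Φ.toHomeo (circlePt t, v))).1)
      ((EuclideanSpace.proj (𝕜 := ℝ) (0 : Fin 2)).smulRight (r • cplxJ (deriv (ambCurve g K) t)) +
        (EuclideanSpace.proj (𝕜 := ℝ) (1 : Fin 2)).smulRight (κ • rotField g (K (circlePt t)).1)) 0) (t : ℝ) :
    HasFDerivAt (fun v : EuclideanSpace ℝ (Fin 2) => ((bBase g).incl ((shrinkTube Φ hμ hμ1).toHomeo (circlePt t, v))).1)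
      ((EuclideanSpace.proj (𝕜 := ℝ) (0 : Fin 2)).smulRight ((μ * r) • cplxJ (deriv (ambCurve g K) t)) +
        (EuclideanSpace.proj (𝕜 := ℝ) (1 : Fin 2)).smulRight ((μ * κ) • rotField g (K (circlePt t)).1)) 0 := by
  have h1 := hasFDerivAt_shrinkTube_fibre Φ hμ hμ1 t (hder t)
  refine h1.congr_fderiv ?_
  ext v i
  simp [ContinuousLinearMap.smulRight_apply, smul_smul]

/-- **Z4's PAGES clause for the shrunk tube**: rate `κ ↦ μ κ`. [folklore] -/
theorem shrinkTube_mem_page {κ : ℝ} {c : ℂ}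
    (hpages : ∀ (ψ : sphere (0 : EuclideanSpace ℝ (Fin 2)) 1) (v : EuclideanSpace ℝ (Fin 2)), ‖v‖ < 1 →
      (bBase g).incl (Φ.toHomeo (ψ, v)) ∈ page g (Complex.exp (Complex.I * κ * v 1) * c))
    (ψ : sphere (0 : EuclideanSpace ℝ (Fin 2)) 1) {v : EuclideanSpace ℝ (Fin 2)} (hv : ‖v‖ < 1) :
    (bBase g).incl ((shrinkTube Φ hμ hμ1).toHomeo (ψ, v)) ∈ page g (Complex.exp (Complex.I * ((μ * κ : ℝ) : ℂ) * v 1) * c) := by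
  rw [shrinkTube_apply]
  have hv' : ‖μ • v‖ < 1 := by
    rw [norm_smul, Real.norm_eq_abs, abs_of_pos hμ]
    calc μ * ‖v‖ ≤ 1 * ‖v‖ := by gcongr
      _ < 1 := by rw [one_mul]; exact hv
  have h1 := hpages ψ (μ • v) hv'
  have e : Complex.I * κ * ((μ • v) 1 : ℝ) = Complex.I * ((μ * κ : ℝ) : ℂ) * v 1 := by
    rw [PiLp.smul_apply, smul_eq_mul]; push_cast; ring
  rwa [e] at h1

end Tubes

/-! ### §2 Points of the tube off the zero section are off the cores -/

section OffCore

variable {ι : Type*} [Finite ι] {h : ι → HandleAttachingMap 3 2 (Base g)}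
  (hd : Pairwise fun i j => Disjoint (range (h i).toFun) (range (h j).toFun)) (i : ι)
  (Φ : CircleTube (bBase g).carrier) (hΦcore : ∀ ψ, (bBase g).incl (Φ.core ψ) = (h i).attachingCircle ψ)

include hd hΦcore in
/-- **A tube point off the zero section is off all cores**, provided the target of the tube lies inside the
range of the handle: it is not on the own attaching circle (the tube map is injective on its source and its core
IS the attaching circle), and the ranges of the handles are pairwise disjoint. [folklore] -/
theorem tube_mem_coresComplement (htarget : Φ.toHomeo.target ⊆ (h i).boundaryTube.toHomeo.target)
    {q : (sphere (0 : EuclideanSpace ℝ (Fin 2)) 1) × EuclideanSpace ℝ (Fin 2)} (hq : q ∈ Φ.toHomeo.source) (hq0 : q.2 ≠ 0) :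
    ((bBase g).incl (Φ.toHomeo q) : Base g) ∈ coresComplement h ∧ ((bBase g).incl (Φ.toHomeo q) : Base g) ∈ range (h i).toFun := by
  have hr : ((bBase g).incl (Φ.toHomeo q) : Base g) ∈ range (h i).toFun := htarget (Φ.toHomeo.map_source hq)
  refine ⟨mem_coresComplement_of_mem_range hd i hr ?_, hr⟩
  rw [← range_attachingCircle]
  rintro ⟨θ, hθ⟩
  rw [← hΦcore θ, CircleTube.core_apply] at hθ
  have h1 : Φ.toHomeo (θ, 0) = Φ.toHomeo q := Subtype.val_injective hθ
  have h2 := Φ.toHomeo.injOn (Φ.mem_source_zero θ) hq h1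
  exact hq0 (by rw [← h2])

end OffCore

/-! ### §3 Registered helper: the tube plumbing of the assembly -/

/-- The Boolean slide direction with `σ s slideSign b = -1` (`σ, s = ±1`). [folklore] -/
theorem exists_slideSign_eq {σ s : ℝ} (hσ : σ ^ 2 = 1) (hs : s ^ 2 = 1) : ∃ b : Bool, σ * s * slideSign b = -1 := by
  rcases sq_eq_one_iff.1 hσ with rfl | rfl <;> rcases sq_eq_one_iff.1 hs with rfl | rfl
  · exact ⟨true, by simp [slideSign]⟩
  · exact ⟨false, by simp [slideSign]⟩
  · exact ⟨false, by simp [slideSign]⟩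
  · exact ⟨true, by simp [slideSign]⟩

/-- **Registered helper `helper_belt_pageTube_prep` (node T3c-1′ of NF6 `stub_steinRealisation`, brick (3c)-GLUE
part 3 = tube plumbing of the assembly, wave 4, lead c5).**  For a Lefschetz link `h` of word `l`, an index `j`,
Z4's page tube `Φ` around `(h j).attachingCircle` (CORE and FIBRE DERIVATIVE clauses) and an open neighbourhood
`O` of its core in `∂ Base g`: there are the twist `σ = t_j`, a sign `s = ±1`, a slide direction `b` with
`σ s slideSign b = -1` and a shrink `μ ∈ (0, 1]` such that the shrunk tube `shrinkTube Φ μ` and the shrunk twisted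
tube `Φ₃ = shrinkTube (twistTube Φ σ) μ` have targets in `O`, and `Φ₃` satisfies the glue hypotheses
`hcore / hsgn / hang` of `helper_belt_slideToTube` against `(h j).boundaryTube`.  (The relation
`Φ₃ (ψ, v) = (shrinkTube Φ μ) (ψ, fibreRot σ ψ v)`, the CORE / FIBRE DERIVATIVE clauses of `shrinkTube Φ μ` and the
off-core property of its points ride along: `shrinkTube_twistTube_apply`, `shrinkTube_core`,
`hasFDerivAt_shrinkTube_fibre`, `tube_mem_coresComplement`.) [cite: Kosinski1993, III (3.5)] -/
theorem helper_belt_pageTube_prep : ∀ (g : ℕ) (l : List ((Fin g ⊕ Fin g → ℤ) × Bool)) (h : Fin l.length → Literature.Topology.FourManifolds.HandleAttachingMap 3 2 (Literature.Topology.FourManifolds.LefschetzBase.Base g)), Literature.Topology.FourManifolds.LefschetzBase.IsLefschetzLink g l h → ∀ (j : Fin l.length) (κ r : ℝ) (Φ : Literature.Topology.FourManifolds.CircleTube (Literature.Topology.FourManifolds.LefschetzBase.bBase g).carrier), 0 < κ → 0 < r → (∀ ψ, (Literature.Topology.FourManifolds.LefschetzBase.bBase g).incl (Φ.core ψ) =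 (h j).attachingCircle ψ) → (∀ t : ℝ, HasFDerivAt (fun v : EuclideanSpace ℝ (Fin 2) => ((Literature.Topology.FourManifolds.LefschetzBase.bBase g).incl (Φ.toHomeo (Literature.Topology.FourManifolds.circlePt t, v))).1) ((EuclideanSpace.proj (𝕜 := ℝ) (0 : Fin 2)).smulRight (r • Literature.Topology.FourManifolds.LefschetzBase.cplxJ (deriv (Literature.Topology.FourManifolds.LefschetzBase.ambCurve g (h j).attachingCircle) t)) + (EuclideanSpace.proj (𝕜 := ℝ) (1 : Fin 2)).smulRight (κ • Summit.SmoothPoincare4.SmoothPoincare4.Theorems.AcyclicBisectionExists.ModpBraidOrbits.rotField g ((h j).attachingCircle (Literature.Topology.FourManifolds.circlePt t)).1)) 0) → ∀ (O : Set (Literature.Topology.FourManifolds.LefschetzBase.bBase g).carrier), IsOpen O → (∀ θ, Φ.core θ ∈ O) → ∃ (σ : ℝ) (hσ : σ ^ 2 = 1) (s : ℝ) (b : Bool) (μ : ℝ) (hμ : 0 < μ) (hμ1 : μ ≤ 1), σ = (if (l.get j).2 then -1 else 1) ∧ s ^ 2 = 1 ∧ σ * s * Summit.SmoothPoincare4.SmoothPoincare4.Theorems.AcyclicBisectionExists.ModpBraidOrbits.slideSign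 b = -1 ∧ (Summit.SmoothPoincare4.SmoothPoincare4.Theorems.AcyclicBisectionExists.ModpBraidOrbits.shrinkTube Φ hμ hμ1).toHomeo.target ⊆ O ∧ (Summit.SmoothPoincare4.SmoothPoincare4.Theorems.AcyclicBisectionExists.ModpBraidOrbits.shrinkTube (Summit.SmoothPoincare4.SmoothPoincare4.Theorems.AcyclicBisectionExists.ModpBraidOrbits.twistTube Φ σ hσ) hμ hμ1).toHomeo.target ⊆ O ∧ (∀ θ, (h j).boundaryTube.core θ = (Summit.SmoothPoincare4.SmoothPoincare4.Theorems.AcyclicBisectionExists.ModpBraidOrbits.shrinkTube (Summit.SmoothPoincare4.SmoothPoincare4.Theorems.AcyclicBisectionExists.ModpBraidOrbits.twistTube Φ σ hσ) hμ hμ1).core θ) ∧ (∀ x, 0 < s * Literature.Topology.FourManifolds.CircleTube.frameSign (h j).boundaryTube (Summit.SmoothPoincare4.SmoothPoincare4.Theorems.AcyclicBisectionExists.ModpBraidOrbits.shrinkTube (Summit.SmoothPoincare4.SmoothPoincare4.Theorems.AcyclicBisectionExists.ModpBraidOrbits.twistTube Φ σ hσ) hμ hμ1) x) ∧ ∃ β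 : Metric.sphere (0 : EuclideanSpace ℝ (Fin 2)) 1 → ℝ, ContMDiff (𝓡 1) 𝓘(ℝ, ℝ) ∞ β ∧ ∀ x, Literature.Topology.FourManifolds.CircleTube.frameVec (h j).boundaryTube (Summit.SmoothPoincare4.SmoothPoincare4.Theorems.AcyclicBisectionExists.ModpBraidOrbits.shrinkTube (Summit.SmoothPoincare4.SmoothPoincare4.Theorems.AcyclicBisectionExists.ModpBraidOrbits.twistTube Φ σ hσ) hμ hμ1) x = Literature.Topology.FourManifolds.rotPlane (β x) Literature.Topology.FourManifolds.planeE0 := by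
  intro g l h hlink j κ r Φ hκ hr hΦcore hΦder O hO hcO
  set σ : ℝ := (if (l.get j).2 then -1 else 1) with hσ_def
  have hσ : σ ^ 2 = 1 := by rw [hσ_def]; split_ifs <;> norm_num
  obtain ⟨hcore₂, ⟨s, hs, hsgn₂⟩, β, hβ, hang₂⟩ := helper_belt_pageTube_glue g l h hlink j κ r Φ hκ hr hΦcore hΦder σ hσ rfl
  obtain ⟨b, hb⟩ := exists_slideSign_eq hσ hs
  -- one shrink of `Φ` into `O`; the shrunk twisted tube has the smaller target (`shrinkTube_twistTube_target_subset`)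
  obtain ⟨μ', hμ', hμ'1, hsub'⟩ := exists_shrinkTube_target_subset (Φ := Φ) hO hcO
  refine ⟨σ, hσ, s, b, μ', hμ', hμ'1, rfl, hs, hb, hsub', (shrinkTube_twistTube_target_subset Φ hσ hμ' hμ'1).trans hsub',
    core_eq_shrinkTube hμ' hμ'1 hcore₂, frameSign_shrinkTube_pos hμ' hμ'1 hcore₂ hsgn₂, β, hβ, fun x => ?_⟩
  exact (frameVec_shrinkTube hμ' hμ'1 hcore₂ x).trans (hang₂ x)

end Summit.SmoothPoincare4.SmoothPoincare4.Theorems.AcyclicBisectionExists.ModpBraidOrbits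

end
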